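import Summits.QuantumAdvantage.QuantumAdvantage.Theorems.CubicForrelationNearExactIsExactFourModSixPrep
import Summits.QuantumAdvantage.QuantumAdvantage.Theorems.CubicForrelationNearExactIsExactEighteenPairing

/-!
# Crux `CubicForrelation.NearExactIsExact` (stmt-QuantumAdvantage-14043) — `n = 6r+4`, TWO-SIDED, second boundary `Φ ≥ 1 − 2^{−(2r+1)}`:
  the level `2r+3` (codimension-2 flat) configuration is empty (`r ≥ 2`) and the levels `≥ 2r+5` force exactness (`r ≥ 3`)

Certificate seat `b2b-cforr-cert` (gen 8).  HONEST FRAMING: preparatory theorems, uniform in `r`, toward the statement that on `n ≡ 4 (mod 6)`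
bits the SECOND dyadic boundary `1 − 2^{−⌊n/3⌋}` is not attained (`n = 16`: the tree's `isolation_sixteen_closed`, gen 6); infinitely many
finite-slice verdicts, NOT summit progress (the constants tend to `1`).

On `n = 6r+4` bits write `W_g = 2^{2r+2}u` (Ax), `s = (−1)^f`, `τ = u − 2^r s`; the budget is `Σ τ² = 2^{8r+5}(1−Φ) ≤ 2^{6r+4} = N` at
`Φ ≥ 1 − 2^{−(2r+1)}` and the pairing is `Σ_y (−1)^g τ̂(y) = 2^{10r+6}(1−Φ) = 2^{8r+5} = 2^{2r+1}N` (`fms_budget`, `fms_pairing`).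
* `f2_levelThree_false` (`r ≥ 2`; the `n = 16` file `…SixteenLevelSeven.lean` in general `r`): `W_g = 2^{2r+3}u'` with some `u'` odd is
  impossible: `p = [u' odd]` is QUADRATIC (tower), every odd point costs `≥ 4` (`u = 2u'`), `RM(2,n)` gives `#P ≥ N/4`, so `P` is an
  `(n−2)`-flat carrying `e = u' − 2^{r−1}s = ±1` and `τ = 2e·1_P`; two transversal directions localise the general 5- and 6-flat sums
  (`8 ∣ Σ₅ u`, `16 ∣ Σ₆ u`; Ax for `f`) to (H3)/(H4) on `P`; the engine `fl1_flat_l1` gives `(Σ|(e1_P)^|)² ≤ 2^{2n+2}` against the pairing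
  `Σ (−1)^g (e1_P)^ = 2^{2r}N`.
* `f2_high_levels` (`r ≥ 3`): `W_g ∈ 2^{2r+5}ℤ` and `Φ ≥ 1 − 2^{−(2r+1)}` force `Φ = 1` (`tms_walk_from` from level `2r+5` with cost exponent
  `2r`; bent end `1 − 2^{1−⌊(3r+5)/2⌋} < 1 − 2^{−(2r+1)}`).

References: J. Ax (1964) / R. J. McEliece (1972); MacWilliams–Sloane (1977) Ch. 13–15; X.-D. Hou (1998); R. O'Donnell (2014) §3.3.  Everything
below is proved from Mathlib and the tree; axioms are the standard three.
-/

set_option linter.dupNamespace false -- D-0017: single-problem summit ⇒ `QuantumAdvantage.QuantumAdvantage` by design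

noncomputable section

namespace Summit.QuantumAdvantage.QuantumAdvantage.Theorems.CubicForrelation.NearExactIsExact

open Finset
open Literature.Computability.QuantumComplexity
open Literature.Computability.QuantumComplexity.BuzetChailloux (bxor zeroVec bxor_bxor_cancel_left bxor_zeroVec zeroVec_bxor bxor_comm
  bxor_self)
open Literature.Computability.QuantumComplexity.DerivativeWalsh (W)

/-- **The levels `≥ 2r+5` on `6r+4` bits at the second boundary (`r ≥ 3`).**  If `W_g ∈ 2^{2r+5}ℤ` and `Φ(f,g) ≥ 1 − 2^{−(2r+1)}` then
`Φ(f,g) = 1`: every level `2r+5 ≤ j ≤ 3r+2` of the tower costs at least `2^{−2r}`, and a bent `g` gives `Φ = 1` or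
`Φ ≤ 1 − 2^{1−⌊(3r+5)/2⌋} < 1 − 2^{−(2r+1)}`.  Uniform in `r`; NOT summit progress. [this work] -/
theorem f2_high_levels (r : ℕ) (hr : 3 ≤ r) (f g : (Fin ((3 * r + 2) + (3 * r + 2)) → Bool) → Bool) (hf : IsDegLeFun 3 f)
    (hg : IsDegLeFun 3 g) (w : (Fin ((3 * r + 2) + (3 * r + 2)) → Bool) → ℤ)
    (hw : ∀ x, W (fun y => signOf (g y)) x = (2 : ℝ) ^ (2 * r + 2 + 1 + 1 + 1) * (w x : ℝ))
    (hΦ : 1 - (1 / 2 : ℝ) ^ (2 * r + 1) ≤ forrelation f g) : forrelation f g = 1 := by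
  obtain ⟨k, rfl⟩ : ∃ k, r = k + 3 := ⟨r - 3, by omega⟩
  rcases tms_walk_from (3 * (k + 3) + 2) (2 * (k + 3) + 2 + 1 + 1 + 1) (2 * k + 6) g hg (by omega) (by omega) w hw
    (by intro j hj hjm; omega) (by omega) with hbent | hcap
  · rcases tw_bent_end (by omega) f g hf hg hbent with h | h
    · exact h
    · exfalso
      have hlt : (1 / 2 : ℝ) ^ (2 * (k + 3) + 1) < 2 / 2 ^ ((3 * (k + 3) + 2 + 3) / 2) := by
        have e : (2 : ℝ) / 2 ^ ((3 * (k + 3) + 2 + 3) / 2) = (1 / 2) ^ ((3 * (k + 3) + 2 + 3) / 2 - 1) := by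
          obtain ⟨a, ha⟩ : ∃ a, (3 * (k + 3) + 2 + 3) / 2 = a + 1 := ⟨(3 * (k + 3) + 2 + 3) / 2 - 1, by omega⟩
          rw [ha, pow_succ, one_div_pow, Nat.add_sub_cancel]
          field_simp
        rw [e]
        exact pow_lt_pow_right_of_lt_one₀ (by norm_num) (by norm_num) (by omega)
      linarith
  · exfalso
    have := tw_forrelation_le_of_cap f g hcap
    have hlt : (1 / 2 : ℝ) ^ (2 * (k + 3) + 1) < (1 / 2) ^ (2 * k + 6) :=
      pow_lt_pow_right_of_lt_one₀ (by norm_num) (by norm_num) (by omega)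
    linarith

/-- **Level `2r+3` at the second boundary on `6r+4` bits is empty (`r ≥ 2`).**  For cubic `f, g : 𝔽₂^{(3r+2)+(3r+2)} → 𝔽₂` with
`W_g = 2^{2r+3}·u'`, some `u'(x)` odd and `Φ(f,g) ≥ 1 − (1/2)^{2r+1}`: contradiction.  Uniform in `r`; NOT summit progress. [this work] -/
theorem f2_levelThree_false (r : ℕ) (hr : 2 ≤ r) (f g : (Fin ((3 * r + 2) + (3 * r + 2)) → Bool) → Bool) (hf : IsDegLeFun 3 f)
    (hg : IsDegLeFun 3 g) (u' : (Fin ((3 * r + 2) + (3 * r + 2)) → Bool) → ℤ)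
    (hu' : ∀ x, W (fun y => signOf (g y)) x = (2 : ℝ) ^ (2 * r + 2 + 1) * (u' x : ℝ)) (hodd : ∃ x, Odd (u' x))
    (hΦ : 1 - (1 / 2 : ℝ) ^ (2 * r + 1) ≤ forrelation f g) : False := by
  classical
  obtain ⟨k, rfl⟩ : ∃ k, r = k + 2 := ⟨r - 2, by omega⟩
  obtain ⟨x₁, hx₁⟩ := hodd
  -- `u = 2u'` at the Ax level `2r+2`
  set u : (Fin ((3 * (k + 2) + 2) + (3 * (k + 2) + 2)) → Bool) → ℤ := fun x => 2 * u' x with hudef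
  have hu : ∀ x, W (fun y => signOf (g y)) x = (2 : ℝ) ^ (2 * (k + 2) + 2) * (u x : ℝ) := by
    intro x; rw [hu' x]; simp only [u]; push_cast; ring
  -- the parity of `u'` is quadratic
  have hp : IsDegLeFun 2 (fun x => decide (Odd (u' x))) :=
    stub_walshTower stub_axParity ((3 * (k + 2) + 2) + (3 * (k + 2) + 2)) (2 * (k + 2) + 2 + 1) 2 g u' hg hu'
      (by intro j hj hjn; omega)
  have hp' : IsDegLeFun (1 + 1) (fun x => decide (Odd (u' x))) := hp
  -- budget `Σ (u' − 2^{r−1} s)² ≤ N/4`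
  have hbud := fms_budget (k + 2) f g u hu
  have hpow : (2 : ℝ) ^ (8 * (k + 2) + 5) * (1 / 2) ^ (2 * (k + 2) + 1) = 2 ^ (6 * k + 16) := by
    rw [one_div_pow]; field_simp; ring
  have hB0 : (∑ x, (u x - 2 ^ (k + 2) * sZ (f x)) ^ 2 : ℤ) ≤ 2 ^ (6 * k + 16) := by
    have h1 : 1 - forrelation f g ≤ (1 / 2 : ℝ) ^ (2 * (k + 2) + 1) := by linarith
    have h' : ((∑ x, (u x - 2 ^ (k + 2) * sZ (f x)) ^ 2 : ℤ) : ℝ) ≤ (2 : ℝ) ^ (6 * k + 16) := by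
      rw [hbud, ← hpow]
      exact mul_le_mul_of_nonneg_left h1 (by positivity)
    exact_mod_cast h'
  have hpow2 : (2 : ℤ) ^ (k + 2) = 2 * 2 ^ (k + 1) := by ring
  have h4 : ∀ x, (u x - 2 ^ (k + 2) * sZ (f x)) ^ 2 = 4 * (u' x - 2 ^ (k + 1) * sZ (f x)) ^ 2 := fun x => by
    simp only [u]; rw [hpow2]; ring
  have hB : (∑ x, (u' x - 2 ^ (k + 1) * sZ (f x)) ^ 2 : ℤ) ≤ 2 ^ (6 * k + 14) := by
    have h'' := hB0
    rw [sum_congr rfl fun x _ => h4 x, ← mul_sum, show (2 : ℤ) ^ (6 * k + 16) = 4 * 2 ^ (6 * k + 14) by ring] at h''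
    linarith
  -- RM: `#P ≥ N/4`
  set P := univ.filter (fun x : Fin ((3 * (k + 2) + 2) + (3 * (k + 2) + 2)) → Bool => Odd (u' x)) with hPdef
  have hmemP : ∀ x, x ∈ P ↔ Odd (u' x) := fun x => by simp [hPdef]
  have hfilt : (univ.filter fun x : Fin ((3 * (k + 2) + 2) + (3 * (k + 2) + 2)) → Bool => decide (Odd (u' x)) = true) = P :=
    filter_congr fun x _ => by simp
  have hRM := bb_rmWeight_holds ((3 * (k + 2) + 2) + (3 * (k + 2) + 2)) 2 (fun x => decide (Odd (u' x))) hp ⟨x₁, by simpa using hx₁⟩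
  rw [hfilt] at hRM
  have hPge : 2 ^ (6 * k + 14) ≤ #P := by
    have h2 : (2 : ℕ) ^ ((3 * (k + 2) + 2) + (3 * (k + 2) + 2)) = 2 ^ 2 * 2 ^ (6 * k + 14) := by ring
    rw [h2] at hRM
    exact Nat.le_of_mul_le_mul_left hRM (by positivity)
  -- everything is tight
  have hsumP : (∑ x, (if Odd (u' x) then 1 else 0 : ℤ)) = #P := by rw [sum_boole]
  have hnonneg : ∀ x, 0 ≤ (u' x - 2 ^ (k + 1) * sZ (f x)) ^ 2 - (if Odd (u' x) then 1 else 0 : ℤ) := by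
    intro x
    by_cases h : Odd (u' x)
    · rw [if_pos h]
      have hodd' : Odd (u' x - 2 ^ (k + 1) * sZ (f x)) := by
        have h2 : Even ((2 : ℤ) ^ (k + 1) * sZ (f x)) := by rw [pow_succ]; exact ⟨2 ^ k * sZ (f x), by ring⟩
        exact Int.odd_sub.2 (iff_of_true h h2)
      have h0 := Int.odd_iff.1 hodd'
      have : u' x - 2 ^ (k + 1) * sZ (f x) ≤ -1 ∨ 1 ≤ u' x - 2 ^ (k + 1) * sZ (f x) := by omega
      have := tp_sq_ge (k := 1) (by norm_num) this
      linarith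
    · rw [if_neg h]; have := sq_nonneg (u' x - 2 ^ (k + 1) * sZ (f x)); linarith
  have hPge' : (2 : ℤ) ^ (6 * k + 14) ≤ #P := by exact_mod_cast hPge
  have hsum0 : ∑ x, ((u' x - 2 ^ (k + 1) * sZ (f x)) ^ 2 - (if Odd (u' x) then 1 else 0 : ℤ)) = 0 := by
    refine le_antisymm ?_ (sum_nonneg fun x _ => hnonneg x)
    rw [sum_sub_distrib, hsumP]
    linarith
  have hzero' : ∀ x, (u' x - 2 ^ (k + 1) * sZ (f x)) ^ 2 - (if Odd (u' x) then 1 else 0 : ℤ) = 0 :=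
    fun x => (sum_eq_zero_iff_of_nonneg fun y _ => hnonneg y).1 hsum0 x (mem_univ x)
  have hoff : ∀ x, ¬ Odd (u' x) → u' x - 2 ^ (k + 1) * sZ (f x) = 0 := by
    intro x hx
    have h := hzero' x
    rw [if_neg hx, sub_zero] at h
    exact (pow_eq_zero_iff two_ne_zero).1 h
  have hon : ∀ x, Odd (u' x) → u' x - 2 ^ (k + 1) * sZ (f x) = 1 ∨ u' x - 2 ^ (k + 1) * sZ (f x) = -1 := by
    intro x hx
    have h := hzero' x
    rw [if_pos hx] at h
    have h1 : (u' x - 2 ^ (k + 1) * sZ (f x)) * (u' x - 2 ^ (k + 1) * sZ (f x)) = 1 := by rw [← pow_two]; linarith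
    exact mul_self_eq_one_iff.1 h1
  have hPcard : #P = 2 ^ (6 * k + 14) := by
    have hle : (#P : ℤ) ≤ 2 ^ (6 * k + 14) := by
      rw [← hsumP]
      exact le_trans (sum_le_sum fun x _ => by have := hnonneg x; linarith) hB
    have hle' : #P ≤ 2 ^ (6 * k + 14) := by exact_mod_cast hle
    exact le_antisymm hle' hPge
  have hTeq : (2 : ℝ) ^ (8 * (k + 2) + 5) * (1 - forrelation f g) = 2 ^ (6 * k + 16) := by
    have hT : (∑ x, (u x - 2 ^ (k + 2) * sZ (f x)) ^ 2 : ℤ) = 2 ^ (6 * k + 16) := by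
      have e4 : ∀ x, (u x - 2 ^ (k + 2) * sZ (f x)) ^ 2 = 4 * ((u' x - 2 ^ (k + 1) * sZ (f x)) ^ 2 -
          (if Odd (u' x) then 1 else 0 : ℤ)) + 4 * (if Odd (u' x) then 1 else 0 : ℤ) := fun x => by rw [h4 x]; ring
      rw [sum_congr rfl fun x _ => e4 x, sum_add_distrib, ← mul_sum, ← mul_sum, hsum0, hsumP, hPcard]
      push_cast; ring
    have h : ((∑ x, (u x - 2 ^ (k + 2) * sZ (f x)) ^ 2 : ℤ) : ℝ) = 2 ^ (6 * k + 16) := by exact_mod_cast hT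
    rw [hbud] at h
    exact h
  -- `P` is an `(n−2)`-flat
  have hmw := mw_flat_of_minweight 1 (fun x => decide (Odd (u' x))) hp' (by rw [hfilt, hPcard]; ring)
  rw [hfilt] at hmw
  obtain ⟨h0, hadd, hcardV, hcoset⟩ := hmw
  set V₀ := univ.filter (fun a : Fin ((3 * (k + 2) + 2) + (3 * (k + 2) + 2)) → Bool => ∀ x,
    decide (Odd (u' (bxor x a))) = decide (Odd (u' x))) with hV₀
  have hS : P = V₀.image (bxor x₁) := hcoset x₁ (by simpa using hx₁)
  rw [hPcard] at hcardV
  have hNcard : #(univ : Finset (Fin ((3 * (k + 2) + 2) + (3 * (k + 2) + 2)) → Bool)) = 2 ^ (6 * k + 16) := by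
    rw [card_univ, Fintype.card_fun, Fintype.card_bool, Fintype.card_fin]; ring
  -- two transversal directions
  obtain ⟨t₁, -, t₂, -, ht₁, ht₂, ht₁₂, ht₂₁⟩ := fl1_dirs2 univ V₀ (by
    rw [hcardV, hNcard]
    have e : (2 : ℕ) ^ (6 * k + 16) = 4 * 2 ^ (6 * k + 14) := by ring
    rw [e]; have hX : 0 < 2 ^ (6 * k + 14) := Nat.two_pow_pos _; linarith)
  -- the sign pattern and the vanishing of the residual off `P`
  set e : (Fin ((3 * (k + 2) + 2) + (3 * (k + 2) + 2)) → Bool) → ℤ := fun x => u' x - 2 ^ (k + 1) * sZ (f x) with hedef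
  have he : ∀ x ∈ P, e x = 1 ∨ e x = -1 := fun x hx => hon x ((hmemP x).1 hx)
  have hF0 : ∀ y, y ∉ P → u y - 2 ^ (k + 2) * sZ (f y) = 0 := by
    intro y hy
    have := hoff y (fun h => hy ((hmemP y).2 h))
    simp only [u]; rw [hpow2]; linarith
  have hFe : ∀ y, u y - 2 ^ (k + 2) * sZ (f y) = 2 * e y := fun y => by simp only [u, e]; rw [hpow2]; ring
  have hPV : ∀ x, x ∈ P → ∀ a ∈ V₀, bxor x a ∈ P := fun x hx a ha => fl1_coset_vadd hadd hS hx ha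
  -- localisation of a `(kk+2)`-flat sum to the inner `kk`-flat of `P`
  have hloc : ∀ {kk : ℕ} (x : Fin ((3 * (k + 2) + 2) + (3 * (k + 2) + 2)) → Bool)
      (a : Fin kk → Fin ((3 * (k + 2) + 2) + (3 * (k + 2) + 2)) → Bool),
      (∀ ε : Fin kk → Bool, (fun j => x j ^^ decide (Odd #(univ.filter fun i => ε i && a i j))) ∈ P) →
      ∑ ε : Fin (kk + 2) → Bool, (u (fun j => x j ^^ decide (Odd #(univ.filter fun i =>
          ε i && (Matrix.vecCons t₁ (Matrix.vecCons t₂ a) : Fin (kk + 2) → Fin ((3 * (k + 2) + 2) + (3 * (k + 2) + 2)) → Bool) i j))) -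
        2 ^ (k + 2) * sZ (f (fun j => x j ^^ decide (Odd #(univ.filter fun i =>
          ε i && (Matrix.vecCons t₁ (Matrix.vecCons t₂ a) : Fin (kk + 2) → Fin ((3 * (k + 2) + 2) + (3 * (k + 2) + 2)) → Bool) i j))))) =
      ∑ ε : Fin kk → Bool, 2 * e (fun j => x j ^^ decide (Odd #(univ.filter fun i => ε i && a i j))) := by
    intro kk x a hin
    have p1 := fr_sum_peel (fun y => u y - 2 ^ (k + 2) * sZ (f y)) x t₁ (Matrix.vecCons t₂ a)
    beta_reduce at p1
    rw [p1]
    have p2 := fr_sum_peel (fun y => u y - 2 ^ (k + 2) * sZ (f y)) x t₂ a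
    beta_reduce at p2
    have p3 := fr_sum_peel (fun y => u (bxor y t₁) - 2 ^ (k + 2) * sZ (f (bxor y t₁))) x t₂ a
    beta_reduce at p3
    rw [p2, p3]
    have z2 : ∑ ε : Fin kk → Bool, (u (bxor (fun j => x j ^^ decide (Odd #(univ.filter fun i => ε i && a i j))) t₂) -
        2 ^ (k + 2) * sZ (f (bxor (fun j => x j ^^ decide (Odd #(univ.filter fun i => ε i && a i j))) t₂))) = 0 :=
      sum_eq_zero fun ε _ => hF0 _ (fl1_coset_out h0 hadd hS (hin ε) ht₂)
    have z1 : ∑ ε : Fin kk → Bool, (u (bxor (fun j => x j ^^ decide (Odd #(univ.filter fun i => ε i && a i j))) t₁) -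
        2 ^ (k + 2) * sZ (f (bxor (fun j => x j ^^ decide (Odd #(univ.filter fun i => ε i && a i j))) t₁))) = 0 :=
      sum_eq_zero fun ε _ => hF0 _ (fl1_coset_out h0 hadd hS (hin ε) ht₁)
    have z21 : ∑ ε : Fin kk → Bool,
        (u (bxor (bxor (fun j => x j ^^ decide (Odd #(univ.filter fun i => ε i && a i j))) t₂) t₁) -
        2 ^ (k + 2) * sZ (f (bxor (bxor (fun j => x j ^^ decide (Odd #(univ.filter fun i => ε i && a i j))) t₂) t₁))) = 0 :=
      sum_eq_zero fun ε _ => by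
        rw [iw_bxor_assoc]
        exact hF0 _ (fl1_coset_out h0 hadd hS (hin ε) ht₂₁)
    rw [z2, z1, z21, add_zero, add_zero, add_zero]
    exact sum_congr rfl fun ε _ => hFe _
  -- (H3) and (H4)
  have H3 : ∀ x ∈ P, ∀ a b c : Fin ((3 * (k + 2) + 2) + (3 * (k + 2) + 2)) → Bool, a ∈ V₀ → b ∈ V₀ → c ∈ V₀ →
      (4 : ℤ) ∣ ∑ ε : Fin 3 → Bool, e (fun j => x j ^^ decide (Odd #(univ.filter fun i =>
        ε i && (![a, b, c] : Fin 3 → Fin ((3 * (k + 2) + 2) + (3 * (k + 2) + 2)) → Bool) i j))) := by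
    intro x hx a b c ha hb hc
    have hin : ∀ ε : Fin 3 → Bool, (fun j => x j ^^ decide (Odd #(univ.filter fun i =>
        ε i && (![a, b, c] : Fin 3 → Fin ((3 * (k + 2) + 2) + (3 * (k + 2) + 2)) → Bool) i j))) ∈ P :=
      fun ε => fr_mem_flatPt3 V₀ h0 (· ∈ P) hPV hx ![a, b, c] (fun i => by fin_cases i <;> assumption) ε
    have h8 := fs_flat_sum_dvd (e := 3) g u hg hu x ![t₁, t₂, a, b, c] (by omega)
    obtain ⟨zf, hzf⟩ := sl_sum_sZ_flat f hf x ![t₁, t₂, a, b, c]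
    have hzf' : ∑ ε : Fin 5 → Bool, 2 ^ (k + 2) * sZ (f (fun j => x j ^^ decide (Odd #(univ.filter fun i =>
          ε i && (![t₁, t₂, a, b, c] : Fin 5 → Fin ((3 * (k + 2) + 2) + (3 * (k + 2) + 2)) → Bool) i j)))) =
        8 * (2 ^ (k + 1) * zf) := by
      rw [← mul_sum, hzf]; norm_num; ring
    have h8n : (8 : ℤ) ∣ ∑ ε : Fin 5 → Bool, u (fun j => x j ^^ decide (Odd #(univ.filter fun i =>
          ε i && (![t₁, t₂, a, b, c] : Fin 5 → Fin ((3 * (k + 2) + 2) + (3 * (k + 2) + 2)) → Bool) i j))) := by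
      have e8 : (2 : ℤ) ^ 3 = 8 := by norm_num
      rw [e8] at h8; exact h8
    have h8' : (8 : ℤ) ∣ ∑ ε : Fin 5 → Bool, (u (fun j => x j ^^ decide (Odd #(univ.filter fun i =>
          ε i && (![t₁, t₂, a, b, c] : Fin 5 → Fin ((3 * (k + 2) + 2) + (3 * (k + 2) + 2)) → Bool) i j))) -
        2 ^ (k + 2) * sZ (f (fun j => x j ^^ decide (Odd #(univ.filter fun i =>
          ε i && (![t₁, t₂, a, b, c] : Fin 5 → Fin ((3 * (k + 2) + 2) + (3 * (k + 2) + 2)) → Bool) i j))))) := by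
      rw [sum_sub_distrib, hzf']
      exact dvd_sub h8n (Dvd.intro _ rfl)
    rw [hloc x ![a, b, c] hin, ← mul_sum] at h8'
    obtain ⟨k8, hk8⟩ := h8'
    exact ⟨k8, by linarith⟩
  have H4 : ∀ x ∈ P, ∀ a₀ a₁ a₂ a₃ : Fin ((3 * (k + 2) + 2) + (3 * (k + 2) + 2)) → Bool, a₀ ∈ V₀ → a₁ ∈ V₀ → a₂ ∈ V₀ → a₃ ∈ V₀ →
      (8 : ℤ) ∣ ∑ ε : Fin 4 → Bool, e (fun j => x j ^^ decide (Odd #(univ.filter fun i =>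
        ε i && (![a₀, a₁, a₂, a₃] : Fin 4 → Fin ((3 * (k + 2) + 2) + (3 * (k + 2) + 2)) → Bool) i j))) := by
    intro x hx a₀ a₁ a₂ a₃ ha₀ ha₁ ha₂ ha₃
    have hin : ∀ ε : Fin 4 → Bool, (fun j => x j ^^ decide (Odd #(univ.filter fun i =>
        ε i && (![a₀, a₁, a₂, a₃] : Fin 4 → Fin ((3 * (k + 2) + 2) + (3 * (k + 2) + 2)) → Bool) i j))) ∈ P :=
      fun ε => fr_mem_flatPt4 V₀ h0 (· ∈ P) hPV hx ![a₀, a₁, a₂, a₃] (fun i => by fin_cases i <;> assumption) ε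
    have h16 := fs_flat_sum_dvd (e := 4) g u hg hu x ![t₁, t₂, a₀, a₁, a₂, a₃] (by omega)
    obtain ⟨zf, hzf⟩ := sl_sum_sZ_flat f hf x ![t₁, t₂, a₀, a₁, a₂, a₃]
    have hzf' : ∑ ε : Fin 6 → Bool, 2 ^ (k + 2) * sZ (f (fun j => x j ^^ decide (Odd #(univ.filter fun i =>
          ε i && (![t₁, t₂, a₀, a₁, a₂, a₃] : Fin 6 → Fin ((3 * (k + 2) + 2) + (3 * (k + 2) + 2)) → Bool) i j)))) =
        16 * (2 ^ k * zf) := by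
      rw [← mul_sum, hzf]; norm_num; ring
    have h16n : (16 : ℤ) ∣ ∑ ε : Fin 6 → Bool, u (fun j => x j ^^ decide (Odd #(univ.filter fun i =>
          ε i && (![t₁, t₂, a₀, a₁, a₂, a₃] : Fin 6 → Fin ((3 * (k + 2) + 2) + (3 * (k + 2) + 2)) → Bool) i j))) := by
      have e16 : (2 : ℤ) ^ 4 = 16 := by norm_num
      rw [e16] at h16; exact h16
    have h16' : (16 : ℤ) ∣ ∑ ε : Fin 6 → Bool, (u (fun j => x j ^^ decide (Odd #(univ.filter fun i =>
          ε i && (![t₁, t₂, a₀, a₁, a₂, a₃] : Fin 6 → Fin ((3 * (k + 2) + 2) + (3 * (k + 2) + 2)) → Bool) i j))) -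
        2 ^ (k + 2) * sZ (f (fun j => x j ^^ decide (Odd #(univ.filter fun i =>
          ε i && (![t₁, t₂, a₀, a₁, a₂, a₃] : Fin 6 → Fin ((3 * (k + 2) + 2) + (3 * (k + 2) + 2)) → Bool) i j))))) := by
      rw [sum_sub_distrib, hzf']
      exact dvd_sub h16n (Dvd.intro _ rfl)
    rw [hloc x ![a₀, a₁, a₂, a₃] hin, ← mul_sum] at h16'
    obtain ⟨k16, hk16⟩ := h16'
    exact ⟨k16, by linarith⟩
  -- the engine and the pairing
  have hE := fl1_flat_l1 V₀ P x₁ h0 hadd hS e he H3 H4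
  set A : (Fin ((3 * (k + 2) + 2) + (3 * (k + 2) + 2)) → Bool) → ℝ := fun x => if x ∈ P then (e x : ℝ) else 0 with hA
  have hAτ : (fun x => (u x : ℝ) - (2 : ℝ) ^ (k + 2) * signOf (f x)) = fun x => 2 * A x := by
    funext x
    have h2 : (u x : ℝ) - (2 : ℝ) ^ (k + 2) * signOf (f x) = (((u x - 2 ^ (k + 2) * sZ (f x) : ℤ)) : ℝ) := by
      push_cast; rw [tp_sZ_cast]
    rw [h2]
    by_cases hx : x ∈ P
    · simp only [A, if_pos hx]; rw [hFe x]; push_cast; ring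
    · simp only [A, if_neg hx]; rw [hF0 x hx]; norm_num
  have hpair := fms_pairing (k + 2) f g u hu
  rw [hAτ] at hpair
  have hpair' : ∑ y, signOf (g y) * W A y = (2 : ℝ) ^ (8 * k + 20) := by
    have e2 : ∀ y, signOf (g y) * W (fun x => 2 * A x) y = 2 * (signOf (g y) * W A y) := fun y => by
      rw [fl1_W_smul]; ring
    rw [sum_congr rfl fun y _ => e2 y, ← mul_sum,
      show (2 : ℝ) ^ (10 * (k + 2) + 6) = 2 ^ (2 * k + 5) * 2 ^ (8 * (k + 2) + 5) by ring, mul_assoc, hTeq] at hpair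
    have e3 : (2 : ℝ) ^ (2 * k + 5) * 2 ^ (6 * k + 16) = 2 * 2 ^ (8 * k + 20) := by ring
    rw [e3] at hpair
    linarith
  have hge : (2 : ℝ) ^ (8 * k + 20) ≤ ∑ y, |W A y| := by rw [← hpair']; exact fl1_pairing_le_l1 g (W A)
  have hsq : ((2 : ℝ) ^ (8 * k + 20)) ^ 2 ≤ (∑ y, |W A y|) ^ 2 := pow_le_pow_left₀ (by positivity) hge 2
  have hEn : (∑ y, |W A y|) ^ 2 ≤ (2 : ℝ) ^ (12 * k + 34) := by
    refine hE.trans (le_of_eq ?_)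
    rw [show ((3 * (k + 2) + 2) + (3 * (k + 2) + 2)) = 6 * k + 16 by ring]
    ring
  have hbig : (2 : ℝ) ^ (12 * k + 34) < ((2 : ℝ) ^ (8 * k + 20)) ^ 2 := by
    have e2 : ((2 : ℝ) ^ (8 * k + 20)) ^ 2 = 2 ^ (12 * k + 34) * 2 ^ (4 * k + 6) := by ring
    rw [e2]
    have h1 : (1 : ℝ) < 2 ^ (4 * k + 6) := one_lt_pow₀ (by norm_num) (by omega)
    have h2 : (0 : ℝ) < 2 ^ (12 * k + 34) := by positivity
    exact lt_mul_of_one_lt_right h2 h1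
  linarith

end Summit.QuantumAdvantage.QuantumAdvantage.Theorems.CubicForrelation.NearExactIsExact

end
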